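import Summits.QuantumFields.BalabanUV.T4Continuum.Support.VariationalVectorOneStepBonds
import Summits.QuantumFields.BalabanUV.T4Continuum.Support.VariationalColourOneStep

/-!
# T⁴ programme, spine node NE2 (U1a), lane P2 — SUPPLIER LEAF V-ONE FOR E-VALUED 1-FORMS («V-ONE-1F»), file 3: BLOCK SUMS, THE SIGNED CROSS TERM,
# AND THE ONE-STEP BOUND FOR THE CURL FORM IN LATTICE UNITS WITH MAIN CONSTANT EXACTLY 1

NE2 formalisation swarm `b2b-balaban-t4-ne2-formalise-*`, leaf prover 01 GEN 6 (`prover-b2b-balaban-t4-ne2-formalise-leaf-01-g6-0`); file 3 of the V-ONE-1F line,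
on top of file 1 `VariationalVectorInterpolant` (tilt `lt`, `Σ_s lt_L(s) = L·wt_L(0)`), file 2 `VariationalVectorOneStepBonds` (`geoV`, `eV`, `tiltErr`, `commErr`,
`norm_curlV_interpV_le`) and leaf-02-g4's 0-form block sums `VariationalColourOneStep.{sum_err2v, sum_norm_err2v_sq_le, re_sum_inner_cDv}` BY NAME.

THE POINT.  For `μ ≠ ν` the block sum of the antisymmetrised face second differences is a covariant derivative OF THE CURL:
    `Σ_j eV(y,j,μ,ν) = (L^{d−1}·wt_L(0)) • [(D_μ curl_{μν})(y) + (D_ν curl_{μν})(y)]`      (`sum_eV`)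
— the transverse weights give `wt_L(0)` on the face by centring (`sum_err2v`), and the longitudinal tilt gives THE SAME number because
`Σ_{s<L}(lt_L − wt_L)(s) = L·wt_L(0)` (`sum_tiltErr`; the own moment the constraint forced in file 1).  Hence the main × error cross term of
`Σ_{y,j}‖L⁻¹•curl_{μν}(y) + eV‖²` is `2·L^{d−2}·wt_L(0)·Re Σ_y⟪curl, (D_μ + D_ν)curl⟫ = +(L−1)∕(2L)·L^{d−2}·(Σ_y‖D_μcurl_{μν}‖² + Σ_y‖D_νcurl_{μν}‖²) ≥ 0` by the
colour CROSS-TERM IDENTITY (unitary `Rc`), NOT by Cauchy–Schwarz — so the main term keeps the constant EXACTLY `L^d∕L²` (`sum_main_sq_le`).  THE END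
(**`curlSq_interpV_le`**, lattice units; `U′`, `Rc` unitary, fine bond operators `R′` with the two frame defects `≤ m`, coarse plaquette defect `‖plaq‖ ≤ p`):
    `curlSq (fine L N) R′ Λ′ ≤ ( √( L^d∕L²·curlSq N Rc W + 8(d+26)·(L^d∕L)·hessV ) + √( d·L^d·(50p²∕L + (32(1+d²)+400)·m²)·nsqV N W ) )²`,
`hessV = Σ_ν hessv(λ_ν)` the full forward covariant Hessian of all components.  File 4 rescales to the road owner's `ScV ∕ SfV ∕ qWV` and reads `blockSpin`.

HONEST FRAMING (T4-DAG p. 1).  Model level (frames ∕ transports DATA); [folklore]; nothing printed is a hypothesis; data `def`s `hessV`, `KV` only, no `def … : Prop`,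
no `sorry`; axioms standard.  ONE block step, the CURL form only (the gauge functional's consistency is leaf V-GF's).  NE2 NOT proved; spine PROVED 0∕9; rung (B)+1
finite T⁴ — NOT infinite volume, NOT mass gap, NOT Clay.  HONEST DEPENDENCY (cell, verbatim): continuum YM on T⁴ ⇐ BetaPertH ∧ nine spine estimates (0/9 proved);
BetaPertH ⇐ (D1) ∧ (D4) ∧ CAP+tail; G-an2-4 gates asym, D1 and NE2/3/4.
-/

noncomputable section

namespace Summit.QuantumFields.BalabanUV.T4Continuum.VariationalVectorOneStep

open Finset
open scoped InnerProductSpace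
open Literature.MathematicalPhysics.QuantumFieldTheory.Balaban1983to89
open Literature.MathematicalPhysics.QuantumFieldTheory.Balaban1983to89.B5Prop11Plancherel (Tor fine unitVec)
open Literature.MathematicalPhysics.QuantumFieldTheory.Balaban1983to89.B5Block118 (bpt)
open Literature.MathematicalPhysics.QuantumFieldTheory.Balaban1983to89.B5AverageCurlStokes (sum_blocks_real)
open Summit.QuantumFields.BalabanUV.T4Continuum.VariationalCovariantFederbush (sum_sq_add_le)
open Summit.QuantumFields.BalabanUV.T4Continuum.VariationalCovariantWeights (wt sum_wt neg_wt_zero_mem sum_ind_last)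
open Summit.QuantumFields.BalabanUV.T4Continuum.VariationalCovariantOneStep (pow_pred_eq)
open Summit.QuantumFields.BalabanUV.T4Continuum.VariationalColourFederbush (cDv dirUv norm_le_one_of_mem_unitary)
open Summit.QuantumFields.BalabanUV.T4Continuum.VariationalColourInterpolant (hessv err2v norm_err2v_le)
open Summit.QuantumFields.BalabanUV.T4Continuum.VariationalColourOneStep (sum_err2v sum_norm_err2v_sq_le re_sum_inner_cDv)
open Summit.QuantumFields.BalabanUV.T4Continuum.VectorBlockTrialForm (nsqV nsqV_nonneg)
open Summit.QuantumFields.BalabanUV.T4Continuum.VariationalVectorForm (curlV curlSq)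
open Summit.QuantumFields.BalabanUV.T4Continuum.VariationalVectorInterpolant (lt sum_lt_fin abs_lt_sub_wt_le PhiFV interpV)

variable {d : ℕ} {E : Type*} [NormedAddCommGroup E] [InnerProductSpace ℂ E] [CompleteSpace E]

/-! ## §1 A two-coordinate face count and the full Hessian of a 1-form -/

section Count

variable (L : ℕ) [NeZero L]

/-- a TWO-COORDINATE face count: `Σ_j [j_μ + 1 = L]·g(j_ν) = L^{d−2}·Σ_i g(i)` for `μ ≠ ν`. [folklore] -/
theorem sum_ind_mul_eval {μ ν : Fin d} (hμν : μ ≠ ν) (g : Fin L → ℝ) :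
    ∑ j : Fin d → Fin L, (if (j μ : ℕ) + 1 = L then (1 : ℝ) else 0) * g (j ν) = (L : ℝ) ^ (d - 2) * ∑ i : Fin L, g i := by
  have hL : 0 < L := Nat.pos_of_ne_zero (NeZero.ne L)
  set ν' : {κ // κ ≠ μ} := ⟨ν, Ne.symm hμν⟩ with hν'
  -- peel off the `μ`-th coordinate
  rw [← (Equiv.funSplitAt μ (Fin L)).symm.sum_comp, Fintype.sum_prod_type]
  have h1 : ∀ (i : Fin L) (r : {κ // κ ≠ μ} → Fin L),
      (if (((Equiv.funSplitAt μ (Fin L)).symm (i, r)) μ : ℕ) + 1 = L then (1 : ℝ) else 0) * g (((Equiv.funSplitAt μ (Fin L)).symm (i, r)) ν)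
        = (if (i : ℕ) + 1 = L then (1 : ℝ) else 0) * g (r ν') := by
    intro i r; simp [hν', Ne.symm hμν]
  simp_rw [h1]
  have h2 : ∑ i : Fin L, ∑ r : {κ // κ ≠ μ} → Fin L, (if (i : ℕ) + 1 = L then (1 : ℝ) else 0) * g (r ν')
      = (∑ i : Fin L, (if (i : ℕ) + 1 = L then (1 : ℝ) else 0)) * ∑ r : {κ // κ ≠ μ} → Fin L, g (r ν') := by
    rw [Finset.sum_mul]; refine sum_congr rfl fun i _ => ?_; rw [Finset.mul_sum]
  have h3 : ∑ i : Fin L, (if (i : ℕ) + 1 = L then (1 : ℝ) else 0) = 1 := by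
    rw [Fintype.sum_eq_single (⟨L - 1, Nat.sub_lt hL one_pos⟩ : Fin L)]
    · exact if_pos (Nat.sub_add_cancel hL)
    · intro i hi; rw [if_neg]; intro h; apply hi; ext; show (i : ℕ) = L - 1; omega
  -- peel off the `ν`-th coordinate of the rest
  have h4 : ∑ r : {κ // κ ≠ μ} → Fin L, g (r ν') = (L : ℝ) ^ (d - 2) * ∑ i : Fin L, g i := by
    rw [← (Equiv.funSplitAt ν' (Fin L)).symm.sum_comp, Fintype.sum_prod_type]
    have h5 : ∀ (i : Fin L) (r' : {j : {κ // κ ≠ μ} // j ≠ ν'} → Fin L), g (((Equiv.funSplitAt ν' (Fin L)).symm (i, r')) ν') = g i := by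
      intro i r'; simp
    simp_rw [h5]
    rw [Finset.sum_comm]
    simp only [sum_const, card_univ, nsmul_eq_mul]
    rw [Fintype.card_fun, Fintype.card_fin, Fintype.card_subtype_compl, Fintype.card_subtype_compl, Fintype.card_fin, Fintype.card_subtype_eq,
      Fintype.card_subtype_eq]
    have hd : 2 ≤ d := by
      have h1 := Fin.pos μ; have : μ.val ≠ ν.val := fun h => hμν (Fin.ext h); have := μ.is_lt; have := ν.is_lt; omega
    push_cast
    rw [show d - 1 - 1 = d - 2 by omega]
  rw [h2, h3, one_mul, h4]

end Count

section Lattice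

variable (L : ℕ) [NeZero L] (N : Fin d → ℕ) [∀ μ, NeZero (N μ)] (Rc : Tor N → Fin d → (E →L[ℂ] E)) (W : Tor N → Fin d → E)

/-- **THE FULL FORWARD COVARIANT HESSIAN OF A 1-FORM**: `hessV W = Σ_ν hessv(λ_ν) = Σ_{ν,a,b} Σ_y ‖(D_aD_bλ_ν)(y)‖²`. [folklore] -/
def hessV : ℝ := ∑ ν, hessv N Rc (fun z => W z ν)

/-- the per-pair Hessian budget: `K_{μν}(y) = Σ_κ (‖D_μD_κλ_ν‖² + ‖D_νD_κλ_μ‖² + ‖D_κD_μλ_ν‖² + ‖D_κD_νλ_μ‖²)(y)`. [folklore] -/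
def KV (y : Tor N) (μ ν : Fin d) : ℝ :=
  ∑ κ, (‖cDv N Rc (fun z => cDv N Rc (fun z => W z ν) z κ) y μ‖ ^ 2 + ‖cDv N Rc (fun z => cDv N Rc (fun z => W z μ) z κ) y ν‖ ^ 2
    + ‖cDv N Rc (fun z => cDv N Rc (fun z => W z ν) z μ) y κ‖ ^ 2 + ‖cDv N Rc (fun z => cDv N Rc (fun z => W z μ) z ν) y κ‖ ^ 2)

omit [NeZero L] [CompleteSpace E] in
/-- `0 ≤ hessV`. [folklore] -/
theorem hessV_nonneg : 0 ≤ hessV N Rc W := sum_nonneg fun _ _ => VariationalColourInterpolant.hessv_nonneg N Rc _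

omit [NeZero L] [CompleteSpace E] in
/-- the four families in `K` each sum to the full Hessian: `Σ_{μ,ν} Σ_y K_{μν}(y) = 4·hessV`. [folklore] -/
theorem sum_KV : ∑ μ, ∑ ν, ∑ y, KV N Rc W y μ ν = 4 * hessV N Rc W := by
  set f : Fin d → Fin d → Fin d → ℝ := fun ν a b => ∑ y, ‖cDv N Rc (fun z => cDv N Rc (fun z => W z ν) z b) y a‖ ^ 2 with hf
  have hhess : hessV N Rc W = ∑ ν, ∑ a, ∑ b, f ν a b := by
    simp only [hessV, hessv, dirUv, hf]
  -- the four families, each a relabelling of `Σ_{ν,a,b} f ν a b`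
  have e1 : ∑ μ, ∑ ν, ∑ κ, f ν μ κ = ∑ ν, ∑ a, ∑ b, f ν a b := Finset.sum_comm
  have e2 : ∑ μ, ∑ ν, ∑ κ, f μ ν κ = ∑ ν, ∑ a, ∑ b, f ν a b := rfl
  have e3 : ∑ μ, ∑ ν, ∑ κ, f ν κ μ = ∑ ν, ∑ a, ∑ b, f ν a b := by
    rw [Finset.sum_comm]; exact sum_congr rfl fun ν _ => Finset.sum_comm
  have e4 : ∑ μ, ∑ ν, ∑ κ, f μ κ ν = ∑ ν, ∑ a, ∑ b, f ν a b := sum_congr rfl fun μ _ => Finset.sum_comm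
  calc ∑ μ, ∑ ν, ∑ y, KV N Rc W y μ ν
      = ∑ μ, ∑ ν, ∑ κ, (f ν μ κ + f μ ν κ + f ν κ μ + f μ κ ν) := by
        refine sum_congr rfl fun μ _ => sum_congr rfl fun ν _ => ?_
        simp only [KV, hf]
        rw [Finset.sum_comm]
        simp only [sum_add_distrib]
    _ = 4 * hessV N Rc W := by
        simp only [sum_add_distrib]
        rw [e1, e2, e3, e4, hhess]; ring

omit [∀ μ, NeZero (N μ)] [CompleteSpace E] in
/-- **BLOCK SUM OF THE LONGITUDINAL FACE TERM** (`μ ≠ ν`): `Σ_j tiltErr(y,j,μ,ν) = (L^{d−1}·wt_L(0)) • (D_νD_μλ_ν)(y)` — because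
`Σ_s (lt_L − wt_L)(s) = L·wt_L(0)`. [folklore] -/
theorem sum_tiltErr {μ ν : Fin d} (hμν : μ ≠ ν) (y : Tor N) :
    ∑ j : Fin d → Fin L, tiltErr L N Rc W y j μ ν
      = ((((L : ℝ) ^ (d - 1) * wt L 0) : ℝ) : ℂ) • cDv N Rc (fun z => cDv N Rc (fun z => W z ν) z μ) y ν := by
  have hL1 : 1 ≤ L := Nat.one_le_iff_ne_zero.mpr (NeZero.ne L)
  have h1 : ∀ j : Fin d → Fin L, tiltErr L N Rc W y j μ ν
      = (((if (j μ : ℕ) + 1 = L then (1 : ℝ) else 0) * (lt L (j ν) - wt L (j ν)) : ℝ) : ℂ) •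
          cDv N Rc (fun z => cDv N Rc (fun z => W z ν) z μ) y ν := by
    intro j; unfold tiltErr; split_ifs <;> simp
  rw [sum_congr rfl fun j _ => h1 j, ← Finset.sum_smul, ← Complex.ofReal_sum, sum_ind_mul_eval L hμν (fun i => lt L i - wt L i)]
  congr 2
  rw [sum_sub_distrib, (sum_lt_fin L).2, sum_wt, sub_zero, ← mul_assoc]
  congr 1
  have hd : 2 ≤ d := by
    have : μ.val ≠ ν.val := fun h => hμν (Fin.ext h); have := μ.is_lt; have := ν.is_lt; omega
  rw [show d - 1 = (d - 2) + 1 by omega, pow_succ]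

omit [NeZero L] [∀ μ, NeZero (N μ)] [CompleteSpace E] in
/-- `cDv` is additive in the field: `D_μ(f − g) = D_μf − D_μg`. [folklore] -/
theorem cDv_sub (f g : Tor N → E) (y : Tor N) (μ : Fin d) :
    cDv N Rc (fun z => f z - g z) y μ = cDv N Rc f y μ - cDv N Rc g y μ := by
  simp only [cDv, map_sub]; abel

omit [∀ μ, NeZero (N μ)] [CompleteSpace E] in
/-- **THE BLOCK SUM OF THE FACE ERRORS IS A COVARIANT DERIVATIVE OF THE CURL** (`μ ≠ ν`):
`Σ_j eV(y,j,μ,ν) = (L^{d−1}·wt_L(0)) • [(D_μ curl_{μν})(y) + (D_ν curl_{μν})(y)]`. [folklore] -/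
theorem sum_eV {μ ν : Fin d} (hμν : μ ≠ ν) (y : Tor N) :
    ∑ j : Fin d → Fin L, eV L N Rc W y j μ ν
      = ((((L : ℝ) ^ (d - 1) * wt L 0) : ℝ) : ℂ) •
          (cDv N Rc (fun z => curlV N Rc W z μ ν) y μ + cDv N Rc (fun z => curlV N Rc W z μ ν) y ν) := by
  have hG : (fun z => curlV N Rc W z μ ν) = fun z => cDv N Rc (fun z => W z ν) z μ - cDv N Rc (fun z => W z μ) z ν := rfl
  unfold eV
  rw [sum_sub_distrib, sum_add_distrib, sum_add_distrib, sum_err2v L N Rc (fun z => W z ν) y μ, sum_err2v L N Rc (fun z => W z μ) y ν,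
    sum_tiltErr L N Rc W hμν y, sum_tiltErr L N Rc W (Ne.symm hμν) y, hG, cDv_sub, cDv_sub]
  simp only [smul_add, smul_sub]
  abel

omit [∀ μ, NeZero (N μ)] [CompleteSpace E] in
/-- `Σ_j ‖tiltErr(y,j,μ,ν)‖² ≤ L^{d−1}·(25∕4)·‖(D_νD_μλ_ν)(y)‖²`. [folklore] -/
theorem sum_norm_tiltErr_sq_le (y : Tor N) (μ ν : Fin d) :
    ∑ j : Fin d → Fin L, ‖tiltErr L N Rc W y j μ ν‖ ^ 2
      ≤ (L : ℝ) ^ (d - 1) * ((25 / 4) * ‖cDv N Rc (fun z => cDv N Rc (fun z => W z ν) z μ) y ν‖ ^ 2) := by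
  have hpt : ∀ j : Fin d → Fin L, ‖tiltErr L N Rc W y j μ ν‖ ^ 2
      ≤ (if (j μ : ℕ) + 1 = L then (1 : ℝ) else 0) * ((25 / 4) * ‖cDv N Rc (fun z => cDv N Rc (fun z => W z ν) z μ) y ν‖ ^ 2) := by
    intro j
    have h := norm_tiltErr_le L N Rc W y j μ ν
    split_ifs at h ⊢ with hj
    · rw [one_mul] at h ⊢
      have h2 := pow_le_pow_left₀ (norm_nonneg _) h 2
      nlinarith [h2]
    · rw [zero_mul] at h ⊢
      rw [le_antisymm h (norm_nonneg _)]; norm_num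
  calc _ ≤ ∑ j : Fin d → Fin L, (if (j μ : ℕ) + 1 = L then (1 : ℝ) else 0) * ((25 / 4) * ‖cDv N Rc (fun z => cDv N Rc (fun z => W z ν) z μ) y ν‖ ^ 2) :=
        sum_le_sum fun j _ => hpt j
    _ = _ := by rw [← Finset.sum_mul, sum_ind_last L μ]

omit [∀ μ, NeZero (N μ)] [CompleteSpace E] in
/-- `Σ_j ‖eV(y,j,μ,ν)‖² ≤ L^{d−1}·(2d + 50)·K_{μν}(y)`. [folklore] -/
theorem sum_norm_eV_sq_le (y : Tor N) (μ ν : Fin d) :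
    ∑ j : Fin d → Fin L, ‖eV L N Rc W y j μ ν‖ ^ 2 ≤ (L : ℝ) ^ (d - 1) * ((2 * (d : ℝ) + 50) * KV N Rc W y μ ν) := by
  have h4 : ∀ j : Fin d → Fin L, ‖eV L N Rc W y j μ ν‖ ^ 2
      ≤ 4 * (‖err2v L N Rc (fun z => W z ν) y j μ‖ ^ 2 + ‖tiltErr L N Rc W y j μ ν‖ ^ 2
        + ‖err2v L N Rc (fun z => W z μ) y j ν‖ ^ 2 + ‖tiltErr L N Rc W y j ν μ‖ ^ 2) := by
    intro j
    set a := ‖err2v L N Rc (fun z => W z ν) y j μ‖ with ha0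
    set b := ‖tiltErr L N Rc W y j μ ν‖ with hb0
    set c := ‖err2v L N Rc (fun z => W z μ) y j ν‖ with hc0
    set e := ‖tiltErr L N Rc W y j ν μ‖ with he0
    have hs : ‖eV L N Rc W y j μ ν‖ ≤ a + b + c + e := by
      unfold eV
      have h := norm_sub_le (err2v L N Rc (fun z => W z ν) y j μ + tiltErr L N Rc W y j μ ν)
        (err2v L N Rc (fun z => W z μ) y j ν + tiltErr L N Rc W y j ν μ)
      have ha := norm_add_le (err2v L N Rc (fun z => W z ν) y j μ) (tiltErr L N Rc W y j μ ν)
      have hb := norm_add_le (err2v L N Rc (fun z => W z μ) y j ν) (tiltErr L N Rc W y j ν μ)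
      linarith
    have h2 := pow_le_pow_left₀ (norm_nonneg _) hs 2
    nlinarith [h2, sq_nonneg (a - b), sq_nonneg (a - c), sq_nonneg (a - e), sq_nonneg (b - c), sq_nonneg (b - e), sq_nonneg (c - e)]
  have hA := sum_norm_err2v_sq_le L N Rc (fun z => W z ν) y μ
  have hB := sum_norm_tiltErr_sq_le L N Rc W y μ ν
  have hC := sum_norm_err2v_sq_le L N Rc (fun z => W z μ) y ν
  have hD := sum_norm_tiltErr_sq_le L N Rc W y ν μ
  have hK1 : ∑ κ, ‖cDv N Rc (fun z => cDv N Rc (fun z => W z ν) z κ) y μ‖ ^ 2 ≤ KV N Rc W y μ ν :=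
    sum_le_sum fun κ _ => by
      linarith [sq_nonneg (‖cDv N Rc (fun z => cDv N Rc (fun z => W z μ) z κ) y ν‖),
        sq_nonneg (‖cDv N Rc (fun z => cDv N Rc (fun z => W z ν) z μ) y κ‖), sq_nonneg (‖cDv N Rc (fun z => cDv N Rc (fun z => W z μ) z ν) y κ‖)]
  have hK2 : ∑ κ, ‖cDv N Rc (fun z => cDv N Rc (fun z => W z μ) z κ) y ν‖ ^ 2 ≤ KV N Rc W y μ ν :=
    sum_le_sum fun κ _ => by
      linarith [sq_nonneg (‖cDv N Rc (fun z => cDv N Rc (fun z => W z ν) z κ) y μ‖),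
        sq_nonneg (‖cDv N Rc (fun z => cDv N Rc (fun z => W z ν) z μ) y κ‖), sq_nonneg (‖cDv N Rc (fun z => cDv N Rc (fun z => W z μ) z ν) y κ‖)]
  have hK3 : ‖cDv N Rc (fun z => cDv N Rc (fun z => W z ν) z μ) y ν‖ ^ 2 ≤ KV N Rc W y μ ν := by
    have h := Finset.single_le_sum (f := fun κ => ‖cDv N Rc (fun z => cDv N Rc (fun z => W z ν) z κ) y μ‖ ^ 2
      + ‖cDv N Rc (fun z => cDv N Rc (fun z => W z μ) z κ) y ν‖ ^ 2 + ‖cDv N Rc (fun z => cDv N Rc (fun z => W z ν) z μ) y κ‖ ^ 2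
      + ‖cDv N Rc (fun z => cDv N Rc (fun z => W z μ) z ν) y κ‖ ^ 2) (fun κ _ => by positivity) (mem_univ ν)
    unfold KV
    nlinarith [h, sq_nonneg (‖cDv N Rc (fun z => cDv N Rc (fun z => W z ν) z ν) y μ‖), sq_nonneg (‖cDv N Rc (fun z => cDv N Rc (fun z => W z μ) z ν) y ν‖),
      sq_nonneg (‖cDv N Rc (fun z => cDv N Rc (fun z => W z μ) z ν) y ν‖)]
  have hK4 : ‖cDv N Rc (fun z => cDv N Rc (fun z => W z μ) z ν) y μ‖ ^ 2 ≤ KV N Rc W y μ ν := by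
    have h := Finset.single_le_sum (f := fun κ => ‖cDv N Rc (fun z => cDv N Rc (fun z => W z ν) z κ) y μ‖ ^ 2
      + ‖cDv N Rc (fun z => cDv N Rc (fun z => W z μ) z κ) y ν‖ ^ 2 + ‖cDv N Rc (fun z => cDv N Rc (fun z => W z ν) z μ) y κ‖ ^ 2
      + ‖cDv N Rc (fun z => cDv N Rc (fun z => W z μ) z ν) y κ‖ ^ 2) (fun κ _ => by positivity) (mem_univ μ)
    unfold KV
    nlinarith [h, sq_nonneg (‖cDv N Rc (fun z => cDv N Rc (fun z => W z ν) z μ) y μ‖), sq_nonneg (‖cDv N Rc (fun z => cDv N Rc (fun z => W z μ) z μ) y ν‖),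
      sq_nonneg (‖cDv N Rc (fun z => cDv N Rc (fun z => W z ν) z μ) y μ‖)]
  have hL0 : (0 : ℝ) ≤ (L : ℝ) ^ (d - 1) := by positivity
  have hd0 : (0 : ℝ) ≤ d := Nat.cast_nonneg d
  calc ∑ j : Fin d → Fin L, ‖eV L N Rc W y j μ ν‖ ^ 2
      ≤ ∑ j : Fin d → Fin L, 4 * (‖err2v L N Rc (fun z => W z ν) y j μ‖ ^ 2 + ‖tiltErr L N Rc W y j μ ν‖ ^ 2
          + ‖err2v L N Rc (fun z => W z μ) y j ν‖ ^ 2 + ‖tiltErr L N Rc W y j ν μ‖ ^ 2) := sum_le_sum fun j _ => h4 j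
    _ = 4 * (∑ j : Fin d → Fin L, ‖err2v L N Rc (fun z => W z ν) y j μ‖ ^ 2 + ∑ j : Fin d → Fin L, ‖tiltErr L N Rc W y j μ ν‖ ^ 2
          + ∑ j : Fin d → Fin L, ‖err2v L N Rc (fun z => W z μ) y j ν‖ ^ 2 + ∑ j : Fin d → Fin L, ‖tiltErr L N Rc W y j ν μ‖ ^ 2) := by
        rw [← mul_sum]; simp only [sum_add_distrib]
    _ ≤ 4 * ((L : ℝ) ^ (d - 1) * ((d : ℝ) / 4 * KV N Rc W y μ ν) + (L : ℝ) ^ (d - 1) * ((25 / 4) * KV N Rc W y μ ν)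
          + (L : ℝ) ^ (d - 1) * ((d : ℝ) / 4 * KV N Rc W y μ ν) + (L : ℝ) ^ (d - 1) * ((25 / 4) * KV N Rc W y μ ν)) := by
        gcongr 4 * (?_ + ?_ + ?_ + ?_)
        · exact hA.trans (by gcongr)
        · exact hB.trans (by gcongr)
        · exact hC.trans (by gcongr)
        · exact hD.trans (by gcongr)
    _ = _ := by ring

/-- **THE MAIN BLOCK SUM** (`μ ≠ ν`, `Rc(·,μ)`, `Rc(·,ν)` unitary): with `G = curl_{μν}`,
`Σ_y Σ_j ‖L⁻¹•G(y) + eV(y,j,μ,ν)‖² ≤ L^d∕L²·Σ_y‖G(y)‖² + (2d + 52)·(L^d∕L)·Σ_y K_{μν}(y)` — expansion EXACT, cross term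
`= +L^{d−2}·(L−1)∕(2L)·(Σ‖D_μG‖² + Σ‖D_νG‖²) ≥ 0` by `sum_eV` + the cross-term identity, bounded by `2·L^{d−2}·ΣK`. [folklore] -/
theorem sum_main_sq_le {μ ν : Fin d} (hμν : μ ≠ ν) (hRcμ : ∀ y, Rc y μ ∈ unitary (E →L[ℂ] E)) (hRcν : ∀ y, Rc y ν ∈ unitary (E →L[ℂ] E)) :
    ∑ y : Tor N, ∑ j : Fin d → Fin L, ‖((L : ℂ))⁻¹ • curlV N Rc W y μ ν + eV L N Rc W y j μ ν‖ ^ 2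
      ≤ (L : ℝ) ^ d / (L : ℝ) ^ 2 * ∑ y, ‖curlV N Rc W y μ ν‖ ^ 2 + (2 * (d : ℝ) + 52) * ((L : ℝ) ^ d / L) * ∑ y, KV N Rc W y μ ν := by
  have hL1 : 1 ≤ L := Nat.one_le_iff_ne_zero.mpr (NeZero.ne L)
  have hL : (0 : ℝ) < L := by exact_mod_cast hL1
  obtain ⟨hpow, hpowle⟩ := pow_pred_eq (d := d) L μ hL1
  obtain ⟨hw0, hw1⟩ := neg_wt_zero_mem L
  have hcard : ((univ : Finset (Fin d → Fin L)).card : ℝ) = (L : ℝ) ^ d := by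
    rw [card_univ, Fintype.card_fun, Fintype.card_fin, Fintype.card_fin]; push_cast; ring
  set G : Tor N → E := fun z => curlV N Rc W z μ ν with hG
  set c : ℝ := (L : ℝ) ^ (d - 1) * wt L 0 with hc
  -- per block: exact expansion
  have hblock : ∀ y : Tor N, ∑ j : Fin d → Fin L, ‖((L : ℂ))⁻¹ • curlV N Rc W y μ ν + eV L N Rc W y j μ ν‖ ^ 2
      = (L : ℝ) ^ d * (((L : ℝ))⁻¹ ^ 2 * ‖G y‖ ^ 2) + ∑ j : Fin d → Fin L, ‖eV L N Rc W y j μ ν‖ ^ 2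
        + 2 * (c * (((L : ℝ))⁻¹ * ((⟪G y, cDv N Rc G y μ⟫_ℂ).re + (⟪G y, cDv N Rc G y ν⟫_ℂ).re))) := by
    intro y
    have ha : ‖((L : ℂ))⁻¹ • curlV N Rc W y μ ν‖ ^ 2 = ((L : ℝ))⁻¹ ^ 2 * ‖G y‖ ^ 2 := by
      rw [norm_smul, norm_inv, Complex.norm_natCast, mul_pow]
    have hmain : ∑ _j : Fin d → Fin L, ‖((L : ℂ))⁻¹ • curlV N Rc W y μ ν‖ ^ 2 = (L : ℝ) ^ d * (((L : ℝ))⁻¹ ^ 2 * ‖G y‖ ^ 2) := by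
      rw [sum_const, nsmul_eq_mul, hcard, ha]
    have hcr : ∑ j : Fin d → Fin L, 2 * (⟪((L : ℂ))⁻¹ • curlV N Rc W y μ ν, eV L N Rc W y j μ ν⟫_ℂ).re
        = 2 * (c * (((L : ℝ))⁻¹ * ((⟪G y, cDv N Rc G y μ⟫_ℂ).re + (⟪G y, cDv N Rc G y ν⟫_ℂ).re))) := by
      rw [← mul_sum, ← Complex.re_sum, ← inner_sum, sum_eV L N Rc W hμν y, inner_smul_right, inner_smul_left, map_inv₀, Complex.conj_natCast,
        inner_add_right]
      congr 1
      have e : ((c : ℝ) : ℂ) * (((L : ℂ))⁻¹ * (⟪G y, cDv N Rc G y μ⟫_ℂ + ⟪G y, cDv N Rc G y ν⟫_ℂ))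
          = ((c : ℝ) : ℂ) * ((((L : ℝ)⁻¹ : ℝ) : ℂ) * (⟪G y, cDv N Rc G y μ⟫_ℂ + ⟪G y, cDv N Rc G y ν⟫_ℂ)) := by push_cast; ring
      rw [e, Complex.re_ofReal_mul, Complex.re_ofReal_mul, Complex.add_re]
    simp_rw [@norm_add_sq ℂ, RCLike.re_to_complex]
    rw [sum_add_distrib, sum_add_distrib, hmain, hcr]
    ring
  rw [sum_congr rfl fun y _ => hblock y, sum_add_distrib, sum_add_distrib, ← mul_sum, ← mul_sum, ← mul_sum, ← mul_sum, ← mul_sum,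
    sum_add_distrib, ← Complex.re_sum, ← Complex.re_sum]
  -- the cross term, exactly
  rw [re_sum_inner_cDv N μ hRcμ G, re_sum_inner_cDv N ν hRcν G]
  -- bounds
  have hK0 : ∀ y, 0 ≤ KV N Rc W y μ ν := fun y => sum_nonneg fun κ _ => by positivity
  have hSK : 0 ≤ ∑ y, KV N Rc W y μ ν := sum_nonneg fun y _ => hK0 y
  have hDμ : ∑ y, ‖cDv N Rc G y μ‖ ^ 2 ≤ 2 * ∑ y, KV N Rc W y μ ν := by
    rw [mul_sum]
    refine sum_le_sum fun y _ => ?_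
    set a : E := cDv N Rc (fun z => cDv N Rc (fun z => W z ν) z μ) y μ with ha
    set b : E := cDv N Rc (fun z => cDv N Rc (fun z => W z μ) z ν) y μ with hb
    have e : cDv N Rc G y μ = a - b := by rw [hG]; exact cDv_sub N Rc _ _ y μ
    have h12 : ‖a‖ ^ 2 + ‖b‖ ^ 2 ≤ KV N Rc W y μ ν := by
      have h := Finset.single_le_sum (f := fun κ => ‖cDv N Rc (fun z => cDv N Rc (fun z => W z ν) z κ) y μ‖ ^ 2
        + ‖cDv N Rc (fun z => cDv N Rc (fun z => W z μ) z κ) y ν‖ ^ 2 + ‖cDv N Rc (fun z => cDv N Rc (fun z => W z ν) z μ) y κ‖ ^ 2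
        + ‖cDv N Rc (fun z => cDv N Rc (fun z => W z μ) z ν) y κ‖ ^ 2) (fun κ _ => by positivity) (mem_univ μ)
      unfold KV
      linarith [h, sq_nonneg (‖cDv N Rc (fun z => cDv N Rc (fun z => W z μ) z μ) y ν‖), sq_nonneg (‖cDv N Rc (fun z => cDv N Rc (fun z => W z ν) z μ) y μ‖)]
    have hsq := pow_le_pow_left₀ (norm_nonneg _) (norm_sub_le a b) 2
    rw [e]
    nlinarith [hsq, h12, sq_nonneg (‖a‖ - ‖b‖)]
  have hDν : ∑ y, ‖cDv N Rc G y ν‖ ^ 2 ≤ 2 * ∑ y, KV N Rc W y μ ν := by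
    rw [mul_sum]
    refine sum_le_sum fun y _ => ?_
    set a : E := cDv N Rc (fun z => cDv N Rc (fun z => W z ν) z μ) y ν with ha
    set b : E := cDv N Rc (fun z => cDv N Rc (fun z => W z μ) z ν) y ν with hb
    have e : cDv N Rc G y ν = a - b := by rw [hG]; exact cDv_sub N Rc _ _ y ν
    have h12 : ‖a‖ ^ 2 + ‖b‖ ^ 2 ≤ KV N Rc W y μ ν := by
      have h := Finset.single_le_sum (f := fun κ => ‖cDv N Rc (fun z => cDv N Rc (fun z => W z ν) z κ) y μ‖ ^ 2
        + ‖cDv N Rc (fun z => cDv N Rc (fun z => W z μ) z κ) y ν‖ ^ 2 + ‖cDv N Rc (fun z => cDv N Rc (fun z => W z ν) z μ) y κ‖ ^ 2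
        + ‖cDv N Rc (fun z => cDv N Rc (fun z => W z μ) z ν) y κ‖ ^ 2) (fun κ _ => by positivity) (mem_univ ν)
      unfold KV
      linarith [h, sq_nonneg (‖cDv N Rc (fun z => cDv N Rc (fun z => W z ν) z ν) y μ‖), sq_nonneg (‖cDv N Rc (fun z => cDv N Rc (fun z => W z μ) z ν) y ν‖)]
    have hsq := pow_le_pow_left₀ (norm_nonneg _) (norm_sub_le a b) 2
    rw [e]
    nlinarith [hsq, h12, sq_nonneg (‖a‖ - ‖b‖)]
  have hE : ∑ y : Tor N, ∑ j : Fin d → Fin L, ‖eV L N Rc W y j μ ν‖ ^ 2 ≤ (L : ℝ) ^ (d - 1) * ((2 * (d : ℝ) + 50) * ∑ y, KV N Rc W y μ ν) := by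
    rw [mul_sum, mul_sum]
    exact sum_le_sum fun y _ => sum_norm_eV_sq_le L N Rc W y μ ν
  -- cross coefficient: `2·c·L⁻¹·(−½)·(A + B) = (−wt 0)·L^{d−1}·L⁻¹·(A+B) ≤ ½·L^{d−1}·4ΣK`
  have hcrossle : 2 * (c * (((L : ℝ))⁻¹ * (-(1 / 2) * ∑ y, ‖cDv N Rc G y μ‖ ^ 2 + -(1 / 2) * ∑ y, ‖cDv N Rc G y ν‖ ^ 2)))
      ≤ 2 * ((L : ℝ) ^ d / L) * ∑ y, KV N Rc W y μ ν := by
    have e : 2 * (c * (((L : ℝ))⁻¹ * (-(1 / 2) * ∑ y, ‖cDv N Rc G y μ‖ ^ 2 + -(1 / 2) * ∑ y, ‖cDv N Rc G y ν‖ ^ 2)))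
        = (-wt L 0) * (((L : ℝ) ^ (d - 1) * ((L : ℝ))⁻¹) * (∑ y, ‖cDv N Rc G y μ‖ ^ 2 + ∑ y, ‖cDv N Rc G y ν‖ ^ 2)) := by
      simp only [hc]; ring
    rw [e]
    have hLinv : ((L : ℝ))⁻¹ ≤ 1 := inv_le_one_of_one_le₀ (by exact_mod_cast hL1)
    have h1 : (L : ℝ) ^ (d - 1) * ((L : ℝ))⁻¹ ≤ (L : ℝ) ^ d / L := by
      rw [hpow]; exact mul_le_of_le_one_right (by positivity) hLinv
    have hAB : ∑ y, ‖cDv N Rc G y μ‖ ^ 2 + ∑ y, ‖cDv N Rc G y ν‖ ^ 2 ≤ 4 * ∑ y, KV N Rc W y μ ν := by linarith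
    have hAB0 : 0 ≤ ∑ y, ‖cDv N Rc G y μ‖ ^ 2 + ∑ y, ‖cDv N Rc G y ν‖ ^ 2 := by positivity
    calc (-wt L 0) * (((L : ℝ) ^ (d - 1) * ((L : ℝ))⁻¹) * (∑ y, ‖cDv N Rc G y μ‖ ^ 2 + ∑ y, ‖cDv N Rc G y ν‖ ^ 2))
        ≤ 1 / 2 * (((L : ℝ) ^ d / L) * (4 * ∑ y, KV N Rc W y μ ν)) :=
          mul_le_mul hw1 (mul_le_mul h1 hAB hAB0 (by positivity)) (by positivity) (by norm_num)
      _ = _ := by ring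
  have hmain : (L : ℝ) ^ d * (((L : ℝ))⁻¹ ^ 2 * ∑ y, ‖G y‖ ^ 2) = (L : ℝ) ^ d / (L : ℝ) ^ 2 * ∑ y, ‖curlV N Rc W y μ ν‖ ^ 2 := by
    rw [inv_pow, hG]; ring
  rw [hpow] at hE
  calc _ ≤ (L : ℝ) ^ d / (L : ℝ) ^ 2 * ∑ y, ‖curlV N Rc W y μ ν‖ ^ 2
        + (L : ℝ) ^ d / L * ((2 * (d : ℝ) + 50) * ∑ y, KV N Rc W y μ ν) + 2 * ((L : ℝ) ^ d / L) * ∑ y, KV N Rc W y μ ν :=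
        add_le_add (add_le_add hmain.le hE) hcrossle
    _ = _ := by ring

end Lattice

end Summit.QuantumFields.BalabanUV.T4Continuum.VariationalVectorOneStep

end
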